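import Summits.QuantumFields.YangMills.Theorems.LangevinControlUVOSLegsAtWeakCouplingCSketchOutputs
import Summits.QuantumFields.YangMills.Theorems.Y2BridgeKing
import HarnessLib

/-!
# Route `InfiniteVolumeContinuum`, support `IVEuclideanInvariance` (stmt-QuantumFields-19933): reduction of the germ stub
# `stub_ivGerm` (W3) to the torus approximation of the continuum data

Lead seat `ym-infvol-p1` (R136 (i)); helper toward the registered stub W3 of the skeleton `IVEuclideanInvariance_proof`
(v2, evidence #2 on 19933).  HONEST FRAMING: existence half only, conditional on Track A's `BalabanLadder.UV`; the lattice
rotation Ward identities `LatticeRotWard G r a` (= the spine's crux `ROT` BY NAME) are a HYPOTHESIS; nothing about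
Yang–Mills is asserted; not a gap, not Clay.

`germ_of_latticeRotWard_of_torusApprox`: if the one-field family `S₁` (`S₁ 1 = 0`, bounded densities off the diagonal) is,
on `⁰𝒮` and in every arity `n ≥ 2`, the limit of the spine's TORUS density functionals
`latticeDist r.ρ (β k) (L k) (a (β k)) tr F² ⟨tr F²⟩ n` along couplings `β_k → ∞` and torus sides with `14 ≤ L_k`,
`a(β_k)⁻² ≤ L_k`, then `LatticeRotWard G r a` makes `S₁` invariant on the germ (off-diagonal tests of small diameter) under
every det-1 isometry of the `(x₀,x₁)`-plane.  This is the gap-free part of the spine's `Sketch.germRotAt_of_latticeWardAt`,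
re-run on this thinner bundle: the tail `k ≥ k₀` (where `0 ≤ β_k`, `a(β_k) ≤ 1/24`) IS an admissible `SpeciesScheme` in
units `a`, the Ward defect vanishes along it (`LatticeRotWard`), the torus functionals converge to `S₁ n D` (hypothesis),
uniqueness of limits gives the Ward identity `S₁ n D = 0` on the germ, and `GermWard.germInvariant_planeRot_of_ward`
integrates it.  What remains for `stub_ivGerm` is ONLY the torus approximation of the DATA clause's limits (seat p2's
junction `exists_torusSides_approximating` + `tendsto_base_of_tendsto_centre` + `latticeDist_dens_eq_sum_latticeDistStr`,
the chain p2 used inside `InfiniteVolumeContinuum.IVData_holds`).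

References: C. King, CMP 103 (1986) 323–349, Thm 2.4 (the Ward mechanism); K. Osterwalder, R. Schrader, CMP 31 (1973).
-/

set_option autoImplicit false

noncomputable section

open MeasureTheory Filter Topology
open scoped BigOperators SchwartzMap
open Literature.MathematicalPhysics.QuantumFieldTheory hiding ZdEdge
open Literature.MathematicalPhysics.QuantumLattice
open Literature.MathematicalPhysics.AQFT
open Summit.QuantumFields.YangMills.Cruxes.OSLegsAtWeakCouplingC.Sketch
  (IsPlanar01 OffDiagDensity GermInvariant Separated SmallDiam tsupport_rotDeriv_subset)
open Summit.QuantumFields.YangMills.Cruxes.OSLegsAtWeakCouplingC.Sketch.GermWard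
  (germInvariant_planeRot_of_ward isOffDiagonal_of_tsupport_subset_separated)
open Summit.QuantumFields.YangMills.Cruxes.OSLegsAtWeakCouplingC.Y2Bridge (LatticeRotWard)
open Summit.QuantumFields.YangMills.Theorems.OSLegsFromFemtoAndGap (latticeDist)
open Summit.QuantumFields.YangMills.Theorems.NPointIsotropy.ComplexRotationBandlimit.Mopup (exists_eq_planeRot)

namespace Summit.QuantumFields.YangMills.Theorems.InfiniteVolume.E1

variable {G : Type} [Group G] [TopologicalSpace G] [IsTopologicalGroup G] [CompactSpace G]
  [MeasurableSpace G] [BorelSpace G]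

/-- **W3 reduced to the torus approximation.**  Couplings `β_k → ∞`, a positive unit `a → 0`, torus sides `L_k` with
`14 ≤ L_k` and `a(β_k)⁻² ≤ L_k`, a one-field family `S₁` with `S₁ 1 = 0` and bounded densities off the diagonal which is
the limit on `⁰𝒮` (arities `≥ 2`) of the spine's torus density functionals along `(β_k, L_k, a(β_k))`: then
`LatticeRotWard G r a` gives `r₁ > 0` such that every det-1 isometry of the `(x₀,x₁)`-plane fixes `S₁` on off-diagonal
tests of diameter `< r₁`. [folklore] -/
theorem germ_of_latticeRotWard_of_torusApprox (r : LatticeRep G) (a : ℝ → ℝ) (β : ℕ → ℝ) (L : ℕ → ℕ)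
    (S₁ : SchwingerFamily (EuclideanSpace ℝ (Fin 4))) (hapos : ∀ b, 0 < a b) (ha0 : Tendsto a atTop (𝓝 0))
    (hROT : LatticeRotWard G r a) (hβ : Tendsto β atTop atTop)
    (hL : ∀ k, 14 ≤ L k ∧ (a (β k))⁻¹ * (a (β k))⁻¹ ≤ L k)
    (h1 : ∀ F : 𝓢((Fin 1 → EuclideanSpace ℝ (Fin 4)), ℂ), S₁ 1 F = 0) (hdens : OffDiagDensity S₁)
    (hconvT : ∀ n : ℕ, 2 ≤ n → ∀ F : 𝓢((Fin n → EuclideanSpace ℝ (Fin 4)), ℂ), IsOffDiagonal F →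
      Tendsto (fun k => latticeDist r.ρ (β k) (L k) (a (β k)) r.curvature.F
        (wilsonTorusMean r.ρ (β k) (L k) r.curvature.F) n F) atTop (𝓝 (S₁ n F))) :
    ∃ r₁ : ℝ, 0 < r₁ ∧ ∀ R : EuclideanSpace ℝ (Fin 4) ≃ₗᵢ[ℝ] EuclideanSpace ℝ (Fin 4),
      LinearMap.det (R.toLinearEquiv : EuclideanSpace ℝ (Fin 4) →ₗ[ℝ] EuclideanSpace ℝ (Fin 4)) = 1 → IsPlanar01 R →
        GermInvariant S₁ R r₁ := by
  -- a tail of the sequence on which the scheme ranges hold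
  obtain ⟨k₀, hk₀⟩ : ∃ k₀ : ℕ, ∀ k, k₀ ≤ k → 0 ≤ β k ∧ a (β k) ≤ 1 / 24 := by
    have h1' : ∀ᶠ k in atTop, 0 ≤ β k := hβ.eventually_ge_atTop 0
    have h2' : ∀ᶠ k in atTop, a (β k) ≤ 1 / 24 :=
      (ha0.comp hβ).eventually (ge_mem_nhds (by norm_num : (0 : ℝ) < 1 / 24))
    obtain ⟨k₀, hk₀⟩ := (h1'.and h2').exists_forall_of_atTop
    exact ⟨k₀, hk₀⟩
  -- the tail as an admissible species scheme in units `a`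
  have htendL : Tendsto (fun k => a (β (k + k₀)) * (L (k + k₀) : ℕ)) atTop atTop := by
    have hinv : Tendsto (fun k => (a (β (k + k₀)))⁻¹) atTop atTop :=
      tendsto_inv_nhdsGT_zero.comp (tendsto_nhdsWithin_iff.2
        ⟨((ha0.comp hβ).comp (tendsto_add_atTop_nat k₀)), Eventually.of_forall fun k => hapos _⟩)
    refine tendsto_atTop_mono (fun k => ?_) hinv
    have ha : 0 < a (β (k + k₀)) := hapos _
    have hLk := (hL (k + k₀)).2
    calc (a (β (k + k₀)))⁻¹ = a (β (k + k₀)) * ((a (β (k + k₀)))⁻¹ * (a (β (k + k₀)))⁻¹) := by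
          field_simp
      _ ≤ a (β (k + k₀)) * (L (k + k₀) : ℕ) := mul_le_mul_of_nonneg_left hLk ha.le
  let sch : SpeciesScheme (YMSpecies G) :=
    { a := fun k => a (β (k + k₀))
      a_pos := fun k => hapos _
      tendsto_a := (ha0.comp hβ).comp (tendsto_add_atTop_nat k₀)
      β := fun k => β (k + k₀)
      L := fun k => L (k + k₀)
      tendsto_L := htendL
      c := fun _ _ => 0
      m := fun _ _ => 0 }
  have hranges : ∀ k, 0 ≤ sch.β k ∧ sch.a k ≤ 1 / 24 ∧ 14 ≤ sch.L k ∧ (sch.a k)⁻¹ * (sch.a k)⁻¹ ≤ sch.L k := fun k =>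
    ⟨(hk₀ (k + k₀) (Nat.le_add_left _ _)).1, (hk₀ (k + k₀) (Nat.le_add_left _ _)).2, (hL (k + k₀)).1, (hL (k + k₀)).2⟩
  obtain ⟨r₀, hr₀, hW⟩ := hROT sch (fun k => rfl) (hβ.comp (tendsto_add_atTop_nat k₀)) hranges
  -- the Ward identity on the germ, by uniqueness of limits along the tail
  have hW' : ∀ (n : ℕ), 2 ≤ n → ∀ (F D : 𝓢((Fin n → EuclideanSpace ℝ (Fin 4)), ℂ)), IsOffDiagonal F →
      HasCompactSupport (F : (Fin n → EuclideanSpace ℝ (Fin 4)) → ℂ) →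
      (∃ δ : ℝ, 0 < δ ∧ tsupport (F : (Fin n → EuclideanSpace ℝ (Fin 4)) → ℂ) ⊆ Separated n δ) →
      tsupport (F : (Fin n → EuclideanSpace ℝ (Fin 4)) → ℂ) ⊆ SmallDiam n r₀ →
      (∀ x, D x = fderiv ℝ (F : (Fin n → EuclideanSpace ℝ (Fin 4)) → ℂ) x
        (fun k => (x k 0) • (EuclideanSpace.single 1 1 : EuclideanSpace ℝ (Fin 4)) -
          (x k 1) • (EuclideanSpace.single 0 1 : EuclideanSpace ℝ (Fin 4)))) →
      S₁ n D = 0 := by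
    intro n hn F D hF hFc hδ hFr hD
    obtain ⟨δ, hδ, hFδ⟩ := hδ
    have hDoff : IsOffDiagonal D :=
      isOffDiagonal_of_tsupport_subset_separated hδ ((tsupport_rotDeriv_subset F D hD).trans hFδ)
    have hlim : Tendsto (fun k => latticeDist r.ρ (sch.β k) (sch.L k) (sch.a k) r.curvature.F
        (wilsonTorusMean r.ρ (sch.β k) (sch.L k) r.curvature.F) n D) atTop (𝓝 (S₁ n D)) :=
      (hconvT n hn D hDoff).comp (tendsto_add_atTop_nat k₀)
    exact tendsto_nhds_unique hlim (hW n hn F D hF hFc ⟨δ, hδ, hFδ⟩ hFr hD)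
  refine ⟨r₀, hr₀, fun R hdet hR => ?_⟩
  obtain ⟨φ, rfl⟩ := exists_eq_planeRot R hdet hR.1 hR.2
  exact germInvariant_planeRot_of_ward S₁ hdens h1 hW' φ

end Summit.QuantumFields.YangMills.Theorems.InfiniteVolume.E1

end
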